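import Summits.BirchSwinnertonDyer.Rank1Residual.Additive.LocIrrValuationCriterionTame
import Summits.BirchSwinnertonDyer.Rank1Residual.Additive.GordIsogenyInvarianceClasses
import Literature.NumberTheory.EllipticCurves.Kraus1997.PTorsionInertiaPotentiallyGood
import Literature.NumberTheory.EllipticCurves.TorsionCardinality
import HarnessLib

/-!
# T-O5-CS on the `(t′)` cell IS Kraus 1997, Prop. 2: `LocIrr W p ↔ ¬ CanonicalSubgroupCriterion p W`
# at every TAME potentially supersingular additive `p ≥ 5` with `e ∈ {3, 4, 6}`, from the published
# theorem (cell `b2b-bsdres`, lane CLASS-CLOSURE, class O5; harvest seat 2, GEN 46, E100)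

HONEST FRAMING (cell `b2b-bsdres`, run/shared/lean/b2b/bsd-rank1-residual/, verbatim in every
file): the goal of the cell is to DELETE the COMBINATION-SHAPED residual classes of the
Birch–Swinnerton-Dyer formula for ALL analytic-rank `≤ 1` elliptic curves over `ℚ` — "full BSD
formula for every rank `≤ 1` curve in class `C`" assembled STRICTLY from published theorems — so
that the rank-`≤ 1` remainder becomes exactly the CONSTRUCTION-SHAPED classes, which are TYPED
(missing-input `Prop`s), NOT attempted. This is not "finishing BSD". Lane CLASS-CLOSURE: research
routes; no claim beyond the stated classes; nothing is booked here; no mark of `RESIDUAL-MAP.md`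
moves. THEOREMS ONLY (no definition, no named fact, no conjecture node).

## What this file does

The theorem-candidate **T-O5-CS** `LocIrrTameIffNoCanonicalSubgroup` of
`Additive/LocIrrValuationCriterionTame.lean` (cc-typer-5 GEN 9, p300590; "harvest-2 E94 DERIVATION +
numerics, EVIDENCE") says: for `p ≥ 5` and `W` in class O5 at `p`, `E[p]|G_{ℚ_p}` is irreducible
iff the free invariant does NOT have its minimal valuation (`¬ CanonicalSubgroupCriterion p W`).
Harvest seat 2 (GEN 46, E100) located and read the printed source: **A. Kraus, Dissertationes
Math. 364 (1997), Prop. 2 with Lemmes 1–2** (typed verbatim-or-weaker as the Literature fact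
`Kraus1997.propTwo_pTorsion_of_supersingular`, p307235): when the good model over
`ℚ_p(p^{v(Δ)/12})` is supersingular, `E[p]` has a `G_{ℚ_p}`-stable line exactly on Kraus's six
exceptional triplets `(v(Δ), v(c₄), v(c₆)) ∈ {(2,1,1), (3,1,2), (4,2,2), (8,3,4), (9,3,5), (10,4,5)}`
and `E[p]|I_p` is irreducible otherwise. Here we prove, granted that fact:

* `canonicalSubgroupCriterion_iff_isExceptionalTriplet` — E94's criterion IS Kraus's list (the
  companion valuation of each triplet is forced by `1728Δ = c₄³ − c₆²`, `p ∤ 1728`); any elliptic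
  `W/ℚ`, any prime `p ≥ 5`.
* `lemmaOneSupersingular_of_subTprime` — on the census cell `(t′)` (`e ∈ {3,4,6}`, `e ∤ p − 1`)
  Kraus's Lemme 1 puts the pair on the supersingular side (`v(Δ) ∈ {2,4,8,10} ∧ p ≡ 2 (3)` or
  `v(Δ) ∈ {3,9} ∧ p ≡ 3 (4)`), using the tree's Kodaira table
  `padicValInt_minimalDiscriminantInt_mem_of_addv_of_padicValRat_j_nonneg`.
* **`locIrr_iff_not_canonicalSubgroupCriterion_of_subTprime`** — T-O5-CS on `(t′)`:
  `Addv W p → SubTprime W p → (LocIrr W p ↔ ¬ CanonicalSubgroupCriterion p W)` (`p ≥ 5`), from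
  Kraus's fact; the stable line of Prop. 2 (a) is neither `⊥` (order `p`) nor `⊤` (`#E[p] = p²`,
  tree theorem `card_torsionBy_eq_sq`).
* `locIrrTameIffNoCanonicalSubgroup_of_kraus_of_subGss` — the whole node T-O5-CS follows from
  Kraus's fact plus ONE classical input on the complementary cell `(G) ∧ ss` (Kodaira `I₀*`, `E` a
  quadratic twist of a good SUPERSINGULAR curve: `E[p]|G_{ℚ_p}` irreducible — Serre 1972 Prop. 12 +
  twist invariance), carried as the explicit binder `hss`; on that cell the criterion is false
  (`v(Δ) = 6`, `canonicalSubgroupCriterion_false_of_Δ_six`).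

So the O5 `(Lgl)` bit at `p ≥ 5` on `(t′)` (census: 4 899 `r = 0` X4 cells, CANON 3 971 /
NOCANON 928 among the pot-ss `e ∈ {3,4,6}` rows of LOCRED5-2ENG v1) is no longer EVIDENCE-labelled:
it is a published theorem (Kraus 1997) read through one cited fact; the `(G) ∧ ss` rows (739, all
NOCANON) wait for the Serre-Prop.-12 input. Nothing booked; no mark moves; O5 stays OPEN (this is the
hypothesis bit of Fouquet–Wan, not a `p`-part statement).

References: A. Kraus, Dissertationes Math. 364 (1997) Lemme 1 (p. 8), Prop. 2 + Lemme 2 (p. 10),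
proof p. 11, §4.2 (pp. 17–20) [Kraus1997Dissertationes]; J. H. Silverman, *ATAEC* IV Table 4.1
[SilvermanATAEC1994]; *AEC* III.6.4 [SilvermanAEC2009]; HOME/b2b-bsdres-harvest-2/gen46/E100-Kraus1997-fidelity-read.md.
-/

noncomputable section

open scoped Classical

open WeierstrassCurve Literature.NumberTheory.EllipticCurves
  Literature.NumberTheory.EllipticCurves.Rank1Residual
  Literature.NumberTheory.EllipticCurves.Kraus1997

namespace Summit.BirchSwinnertonDyer.Rank1Residual.Additive

/-! ## §1 E94's criterion = Kraus's six exceptional triplets (valuation algebra) -/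

section Dictionary

variable {p : ℕ} [hp : Fact p.Prime] (W : WeierstrassCurve ℚ) [W.IsElliptic]

/-- `v_p(1728) = 0` for `p ≥ 5`. [folklore] -/
private theorem padicValRat_1728_eq_zero (hp5 : 5 ≤ p) : padicValRat p (1728 : ℚ) = 0 := by
  have h1728 : (1728 : ℚ) = ((2 ^ 6 * 3 ^ 3 : ℕ) : ℚ) := by norm_num
  rw [h1728, padicValRat.of_nat, Nat.cast_eq_zero, padicValNat.eq_zero_of_not_dvd]
  intro h
  have h2 : ¬ p ∣ 2 ^ 6 := fun h' ↦ by
    have := (Nat.prime_dvd_prime_iff_eq hp.out Nat.prime_two).mp (hp.out.dvd_of_dvd_pow h')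
    omega
  have h3 : ¬ p ∣ 3 ^ 3 := fun h' ↦ by
    have := (Nat.prime_dvd_prime_iff_eq hp.out Nat.prime_three).mp (hp.out.dvd_of_dvd_pow h')
    omega
  exact (Nat.Prime.dvd_mul hp.out).mp h |>.elim h2 h3

/-- `v_p(1728 Δ) = v_p(Δ)` for `p ≥ 5`. [folklore] -/
private theorem padicValRat_1728_mul_Δ (hp5 : 5 ≤ p) :
    padicValRat p (1728 * W.Δ) = padicValRat p W.Δ := by
  rw [padicValRat.mul (by norm_num) W.isUnit_Δ.ne_zero, padicValRat_1728_eq_zero hp5, zero_add]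

/-- From `v(c₄) = a`, `v(Δ) = d` with `d < 3a` (and `a ≠ 0`): `c₆ ≠ 0` and `2 v(c₆) = d`
(`c₆² = c₄³ − 1728Δ`, the `Δ`-term has the smaller valuation). [folklore] -/
private theorem two_mul_padicValRat_c₆_eq (hp5 : 5 ≤ p) {a d : ℤ} (ha : padicValRat p W.c₄ = a)
    (hd : padicValRat p W.Δ = d) (ha0 : a ≠ 0) (hlt : d < 3 * a) :
    2 * padicValRat p W.c₆ = d := by
  have hΔ0 : W.Δ ≠ 0 := W.isUnit_Δ.ne_zero
  have hc4 : W.c₄ ≠ 0 := by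
    rintro h; rw [h, padicValRat.zero] at ha; exact ha0 ha.symm
  have hrel : W.c₆ ^ 2 = -(1728 * W.Δ) + W.c₄ ^ 3 := by
    have := W.c_relation; linear_combination this
  have hvΔ : padicValRat p (-(1728 * W.Δ)) = d := by
    rw [padicValRat.neg, padicValRat_1728_mul_Δ W hp5, hd]
  have hv4 : padicValRat p (W.c₄ ^ 3) = 3 * a := by rw [padicValRat.pow, ha]; push_cast; ring
  have hne : -(1728 * W.Δ) + W.c₄ ^ 3 ≠ 0 := by
    intro h0
    have h1 : W.c₄ ^ 3 = 1728 * W.Δ := by linear_combination h0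
    have h2 := congrArg (padicValRat p) h1
    rw [hv4, padicValRat_1728_mul_Δ W hp5, hd] at h2
    omega
  have hsum : padicValRat p (-(1728 * W.Δ) + W.c₄ ^ 3) = d := by
    rw [padicValRat.add_eq_of_lt hne (neg_ne_zero.mpr (mul_ne_zero (by norm_num) hΔ0))
      (pow_ne_zero 3 hc4) (by rw [hvΔ, hv4]; exact hlt), hvΔ]
  have hc6 : W.c₆ ≠ 0 := by
    rintro h
    rw [h, zero_pow two_ne_zero] at hrel
    exact hne hrel.symm
  rw [← hsum, ← hrel, padicValRat.pow]; push_cast; ring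

/-- From `v(c₆) = b`, `v(Δ) = d` with `d < 2b` (and `b ≠ 0`): `3 v(c₄) = d`
(`c₄³ = c₆² + 1728Δ`). [folklore] -/
private theorem three_mul_padicValRat_c₄_eq (hp5 : 5 ≤ p) {b d : ℤ} (hb : padicValRat p W.c₆ = b)
    (hd : padicValRat p W.Δ = d) (hb0 : b ≠ 0) (hlt : d < 2 * b) :
    3 * padicValRat p W.c₄ = d := by
  have hΔ0 : W.Δ ≠ 0 := W.isUnit_Δ.ne_zero
  have hc6 : W.c₆ ≠ 0 := by
    rintro h; rw [h, padicValRat.zero] at hb; exact hb0 hb.symm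
  have hrel : W.c₄ ^ 3 = 1728 * W.Δ + W.c₆ ^ 2 := by
    have := W.c_relation; linear_combination -this
  have hvΔ : padicValRat p (1728 * W.Δ) = d := by rw [padicValRat_1728_mul_Δ W hp5, hd]
  have hv6 : padicValRat p (W.c₆ ^ 2) = 2 * b := by rw [padicValRat.pow, hb]; push_cast; ring
  have hne : 1728 * W.Δ + W.c₆ ^ 2 ≠ 0 := by
    intro h0
    have h1 : W.c₆ ^ 2 = -(1728 * W.Δ) := by linear_combination h0
    have h2 := congrArg (padicValRat p) h1
    rw [hv6, padicValRat.neg, padicValRat_1728_mul_Δ W hp5, hd] at h2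
    omega
  have hsum : padicValRat p (1728 * W.Δ + W.c₆ ^ 2) = d := by
    rw [padicValRat.add_eq_of_lt hne (mul_ne_zero (by norm_num) hΔ0) (pow_ne_zero 2 hc6)
      (by rw [hvΔ, hv6]; exact hlt), hvΔ]
  have hc4 : W.c₄ ≠ 0 := by
    rintro h
    rw [h, zero_pow three_ne_zero] at hrel
    exact hne hrel.symm
  rw [← hsum, ← hrel, padicValRat.pow]; push_cast; ring

/-- **E94's canonical-subgroup criterion IS Kraus's list of six exceptional triplets** (`p ≥ 5`,
`W` elliptic): `CanonicalSubgroupCriterion p W ↔ Kraus1997.IsExceptionalTriplet p W`. The criterion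
names only the free invariant (`v(c₄)` on II/II*/IV/IV*, `v(c₆)` on III/III*); the other valuation
is forced by `1728Δ = c₄³ − c₆²` (Kraus's preliminary table, p. 8: `v(Δ) = 2 ⇒ v(c₆) = 1`, …).
[cite: Kraus1997Dissertationes, §I.B.1 no. 1 table (p. 8) and Lemme 2 (p. 10)] -/
theorem canonicalSubgroupCriterion_iff_isExceptionalTriplet (hp5 : 5 ≤ p) :
    CanonicalSubgroupCriterion p W ↔ IsExceptionalTriplet p W := by
  constructor
  · rintro (⟨hd, ha⟩ | ⟨hd, ha⟩ | ⟨hd, ha⟩ | ⟨hd, ha⟩ | ⟨hd, hb⟩ | ⟨hd, hb⟩)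
    · have h := two_mul_padicValRat_c₆_eq W hp5 ha hd (by norm_num) (by norm_num)
      exact Or.inl ⟨hd, ha, by omega⟩
    · have h := two_mul_padicValRat_c₆_eq W hp5 ha hd (by norm_num) (by norm_num)
      exact Or.inr (Or.inr (Or.inr (Or.inr (Or.inr ⟨hd, ha, by omega⟩))))
    · have h := two_mul_padicValRat_c₆_eq W hp5 ha hd (by norm_num) (by norm_num)
      exact Or.inr (Or.inr (Or.inl ⟨hd, ha, by omega⟩))
    · have h := two_mul_padicValRat_c₆_eq W hp5 ha hd (by norm_num) (by norm_num)
      exact Or.inr (Or.inr (Or.inr (Or.inl ⟨hd, ha, by omega⟩)))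
    · have h := three_mul_padicValRat_c₄_eq W hp5 hb hd (by norm_num) (by norm_num)
      exact Or.inr (Or.inl ⟨hd, by omega, hb⟩)
    · have h := three_mul_padicValRat_c₄_eq W hp5 hb hd (by norm_num) (by norm_num)
      exact Or.inr (Or.inr (Or.inr (Or.inr (Or.inl ⟨hd, by omega, hb⟩))))
  · rintro (⟨hd, ha, -⟩ | ⟨hd, -, hb⟩ | ⟨hd, ha, -⟩ | ⟨hd, ha, -⟩ | ⟨hd, -, hb⟩ | ⟨hd, ha, -⟩)
    · exact Or.inl ⟨hd, ha⟩
    · exact Or.inr (Or.inr (Or.inr (Or.inr (Or.inl ⟨hd, hb⟩))))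
    · exact Or.inr (Or.inr (Or.inl ⟨hd, ha⟩))
    · exact Or.inr (Or.inr (Or.inr (Or.inl ⟨hd, ha⟩)))
    · exact Or.inr (Or.inr (Or.inr (Or.inr (Or.inr ⟨hd, hb⟩))))
    · exact Or.inr (Or.inl ⟨hd, ha⟩)

end Dictionary

/-! ## §2 The `(t′)` cell lies on the supersingular side of Kraus's Lemme 1 -/

section Cell

variable (W : WeierstrassCurve ℚ) [W.IsElliptic] [W.IsGloballyMinimal] (p : ℕ) [hp : Fact p.Prime]

/-- **On `(t′)` at `p ≥ 5`: `v_p(Δ_min) ∈ {2,4,8,10}` with `p ≡ 2 (mod 3)`, or `v_p(Δ_min) ∈ {3,9}`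
with `p ≡ 3 (mod 4)`** — i.e. Kraus's Lemme 1 gives `h = 2`. From the Kodaira table at an additive
potentially good `p ≥ 5` (`v ∈ {2,3,4,6,8,9,10}`,
`padicValInt_minimalDiscriminantInt_mem_of_addv_of_padicValRat_j_nonneg`) and `e = 12/gcd(12,v) ∤ p − 1`:
`v = 6` gives `e = 2 ∣ p − 1` (excluded), `v ∈ {4,8}`: `e = 3`, `v ∈ {2,10}`: `e = 6`, both
`⇒ 3 ∤ p − 1`; `v ∈ {3,9}`: `e = 4 ∤ p − 1`. [cite: Kraus1997Dissertationes, Lemme 1 (p. 8)] -/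
theorem lemmaOneSupersingular_of_subTprime (hp5 : 5 ≤ p) (hadd : Addv W p) (hT : SubTprime W p) :
    LemmaOneSupersingular p W := by
  obtain ⟨hnot, -, hndvd⟩ := hT
  have hj : 0 ≤ padicValRat p W.j := not_lt.mp hnot
  have hΔ := padicValRat_Δ_eq W p
  have hpodd : p % 2 = 1 := by
    rcases Nat.even_or_odd p with he | ho
    · exfalso
      have := (Nat.prime_dvd_prime_iff_eq Nat.prime_two hp.out).mp he.two_dvd
      omega
    · exact Nat.odd_iff.mp ho
  have hp3 : p % 3 ≠ 0 := by
    intro h0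
    have h3 : 3 ∣ p := Nat.dvd_of_mod_eq_zero h0
    have := (Nat.prime_dvd_prime_iff_eq Nat.prime_three hp.out).mp h3
    omega
  unfold semistabilityIndex at hndvd
  unfold LemmaOneSupersingular
  rcases padicValInt_minimalDiscriminantInt_mem_of_addv_of_padicValRat_j_nonneg W p hp5 hadd hj with
    hv | hv | hv | hv | hv | hv | hv <;> rw [hv] at hndvd hΔ <;> norm_num at hndvd hΔ
  · exact Or.inl ⟨Or.inl hΔ, by omega⟩
  · exact Or.inr ⟨Or.inl hΔ, by omega⟩
  · exact Or.inl ⟨Or.inr (Or.inl hΔ), by omega⟩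
  · exfalso; omega
  · exact Or.inl ⟨Or.inr (Or.inr (Or.inl hΔ)), by omega⟩
  · exact Or.inr ⟨Or.inr (Or.inl hΔ), by omega⟩
  · exact Or.inl ⟨Or.inr (Or.inr (Or.inr (Or.inl hΔ))), by omega⟩

/-- On `(G) ∧ ss` at `p ≥ 5` the criterion is false: the cell is Kodaira `I₀*`, `v_p(Δ_min) = 6`
(`SubGss.subGordTwo`: `e = 2`, i.e. `6 ∣ v`, and `v ∈ {2,3,4,6,8,9,10}`).
[cite: Kraus1997Dissertationes, Lemme 2 (p. 10), case v(Δ) = 6] -/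
theorem not_canonicalSubgroupCriterion_of_subGss (hp5 : 5 ≤ p) (hadd : Addv W p) (hG : SubGss W p) :
    ¬ CanonicalSubgroupCriterion p W := by
  have hp2 : p ≠ 2 := by omega
  obtain ⟨⟨hnot, -, -⟩, he⟩ := SubGss.subGordTwo W p hp2 hadd hG
  have hj : 0 ≤ padicValRat p W.j := not_lt.mp hnot
  have hΔ := padicValRat_Δ_eq W p
  unfold semistabilityIndex at he
  apply canonicalSubgroupCriterion_false_of_Δ_six
  rcases padicValInt_minimalDiscriminantInt_mem_of_addv_of_padicValRat_j_nonneg W p hp5 hadd hj with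
    hv | hv | hv | hv | hv | hv | hv <;> rw [hv] at he hΔ <;> norm_num at he
  exact_mod_cast hΔ

end Cell

/-! ## §3 T-O5-CS on `(t′)` from Kraus's Proposition 2 -/

section Main

variable (W : WeierstrassCurve ℚ) [W.IsElliptic] [W.IsGloballyMinimal] (p : ℕ) [hp : Fact p.Prime]

omit [W.IsGloballyMinimal] in
/-- `#E[p](ℚ̄_p) = p²` for the base change to `ℚ_p` (*AEC* III.6.4, tree theorem
`card_torsionBy_eq_sq`). [cite: SilvermanAEC2009, Cor. III.6.4(b)] -/
theorem natCard_geomTorsion_baseChange_padic :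
    Nat.card (geomTorsion (W.baseChange ℚ_[p]) (p : ℤ)) = p ^ 2 := by
  have hp0 : ((p : ℕ) : AlgebraicClosure ℚ_[p]) ≠ 0 := by
    rw [← map_natCast (algebraMap ℚ_[p] (AlgebraicClosure ℚ_[p])) p]
    exact (map_ne_zero_iff _ (algebraMap ℚ_[p] _).injective).mpr
      (by exact_mod_cast hp.out.ne_zero)
  exact ((W.baseChange ℚ_[p]).baseChange (AlgebraicClosure ℚ_[p])).card_torsionBy_eq_sq hp0

omit [W.IsGloballyMinimal] in
/-- A `Γ_{ℚ_p}`-stable subgroup of order `p` in `E[p](ℚ̄_p)` makes `E[p]|G_{ℚ_p}` REDUCIBLE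
(it is neither `⊥`, of order `1`, nor `⊤`, of order `p²`). [folklore] -/
theorem not_locIrr_of_exists_stable_addSubgroup
    (h : ∃ H : AddSubgroup (geomTorsion (W.baseChange ℚ_[p]) (p : ℤ)),
      (∀ (σ : Field.absoluteGaloisGroup ℚ_[p]) (P : geomTorsion (W.baseChange ℚ_[p]) (p : ℤ)),
          P ∈ H → σ • P ∈ H) ∧ Nat.card H = p) :
    ¬ LocIrr W p := by
  obtain ⟨H, hstab, hcard⟩ := h
  intro hirr
  have hp1 : 1 < p := hp.out.one_lt
  rcases hirr H (fun σ P hP ↦ hstab σ P hP) with hbot | htop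
  · rw [hbot, AddSubgroup.card_bot] at hcard
    omega
  · have htop' : Nat.card H = Nat.card (geomTorsion (W.baseChange ℚ_[p]) (p : ℤ)) := by
      rw [htop]; exact Nat.card_congr (AddSubgroup.topEquiv.toEquiv)
    rw [hcard, natCard_geomTorsion_baseChange_padic W p] at htop'
    have : p * 1 = p * p := by rw [mul_one, ← sq]; exact htop'
    have := Nat.eq_of_mul_eq_mul_left (by omega) this
    omega

/-- **T-O5-CS on the `(t′)` cell, from Kraus 1997 Prop. 2** (`p ≥ 5`, `W` elliptic and globally
minimal, additive at `p`, census cell `(t′)`: `e ∈ {3,4,6}`, `e ∤ p − 1`): `E[p]|G_{ℚ_p}` is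
irreducible iff the free invariant does NOT take its minimal valuation. (⇒) on the criterion rows
(= Kraus's six triplets) Prop. 2 (a) gives a stable line of order `p`; (⇐) off them Prop. 2 (b)
gives irreducibility already under inertia; Lemme 1 supplies `h = 2` on `(t′)`.
[cite: Kraus1997Dissertationes, Prop. 2 (p. 10), Lemme 1 (p. 8), Lemme 2 (p. 10), §I.B.1 no. 4.2 (pp. 17–20)] -/
theorem locIrr_iff_not_canonicalSubgroupCriterion_of_subTprime
    (hK : propTwo_pTorsion_of_supersingular) (hp5 : 5 ≤ p) (hadd : Addv W p) (hT : SubTprime W p) :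
    LocIrr W p ↔ ¬ CanonicalSubgroupCriterion p W := by
  have hj : 0 ≤ padicValRat p W.j := not_lt.mp hT.1
  have hss := lemmaOneSupersingular_of_subTprime W p hp5 hadd hT
  have hKW := hK p hp5 W hadd hj hss
  rw [canonicalSubgroupCriterion_iff_isExceptionalTriplet W hp5]
  constructor
  · intro hirr hex
    exact not_locIrr_of_exists_stable_addSubgroup W p (hKW.1 hex) hirr
  · intro hne
    exact hKW.2 hne

/-- The LocRed half alone: a criterion row of `(t′)` at `p ≥ 5` has `E[p]|G_{ℚ_p}` REDUCIBLE
(the census's CANON rows). [cite: Kraus1997Dissertationes, Prop. 2 (a) (p. 10), proof p. 11] -/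
theorem not_locIrr_of_canonicalSubgroupCriterion_of_subTprime
    (hK : propTwo_pTorsion_of_supersingular) (hp5 : 5 ≤ p) (hadd : Addv W p) (hT : SubTprime W p)
    (hc : CanonicalSubgroupCriterion p W) : ¬ LocIrr W p := fun hirr ↦
  (locIrr_iff_not_canonicalSubgroupCriterion_of_subTprime W p hK hp5 hadd hT).mp hirr hc

/-- The LocIrr half alone: off the criterion rows, a `(t′)` pair at `p ≥ 5` has `E[p]|G_{ℚ_p}`
IRREDUCIBLE (the census's NOCANON rows; the Fouquet–Wan (Lgl) bit holds).
[cite: Kraus1997Dissertationes, Prop. 2 (b) (p. 10), §I.B.1 no. 4.2 3) (pp. 19–20)] -/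
theorem locIrr_of_not_canonicalSubgroupCriterion_of_subTprime
    (hK : propTwo_pTorsion_of_supersingular) (hp5 : 5 ≤ p) (hadd : Addv W p) (hT : SubTprime W p)
    (hc : ¬ CanonicalSubgroupCriterion p W) : LocIrr W p :=
  (locIrr_iff_not_canonicalSubgroupCriterion_of_subTprime W p hK hp5 hadd hT).mpr hc

/-- **The node T-O5-CS from Kraus's fact plus the classical `(G) ∧ ss` input.** Granted
`Kraus1997.propTwo_pTorsion_of_supersingular` and, on the complementary cell `(G) ∧ ss` of O5
(Kodaira `I₀*`: `E` is the `χ_{p*}`-twist of a curve with good SUPERSINGULAR reduction), the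
irreducibility of `E[p]|G_{ℚ_p}` (Serre 1972 §1.11 Prop. 12 for the twist, plus twist invariance
of `LocIrr` — NOT in the tree at `p ≥ 5`; binder `hss`), the theorem-candidate
`LocIrrTameIffNoCanonicalSubgroup` holds. [cite: Kraus1997Dissertationes, Prop. 2 (p. 10)]
[cite: Serre1972, §1.11 Prop. 12] -/
theorem locIrrTameIffNoCanonicalSubgroup_of_kraus_of_subGss
    (hK : propTwo_pTorsion_of_supersingular)
    (hss : ∀ (p : ℕ) [Fact p.Prime], 5 ≤ p →
      ∀ (W : WeierstrassCurve ℚ) [W.IsElliptic] [W.IsGloballyMinimal],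
        Addv W p → SubGss W p → LocIrr W p) :
    LocIrrTameIffNoCanonicalSubgroup := by
  intro p _ hp5 W _ _ hO
  obtain ⟨-, hadd, hG | hT⟩ := hO
  · exact ⟨fun _ ↦ not_canonicalSubgroupCriterion_of_subGss W p hp5 hadd hG,
      fun _ ↦ hss p hp5 W hadd hG⟩
  · exact locIrr_iff_not_canonicalSubgroupCriterion_of_subTprime W p hK hp5 hadd hT

end Main

end Summit.BirchSwinnertonDyer.Rank1Residual.Additive

end
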